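import Mathlib.Analysis.SpecialFunctions.Log.Basic
import Mathlib.LinearAlgebra.Matrix.DotProduct

/-!
# Route `AnisotropyChord`: the TANGENT CRITERION for overlap monotonicity and TP₂ of a Gram kernel
# (theory seat `hubbard-h0-rotor-theory-1`, cycle 6, memo ROTOR-THEORY-6 §58; abstract, no lattice)

A discrete curve of unit vectors `ψ : ℕ → (Fin d → ℝ)` whose INCREMENTS have pairwise non-negative
inner products, `0 ≤ ⟨ψ_{i+1} − ψ_i, ψ_{j+1} − ψ_j⟩` ("tangent positivity"), has an overlap-monotone and
TP₂ Gram matrix.  Applied to `ψ i = ψ_W(Δ_i)` (Perron–Frobenius representatives of the sector ground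
states on a grid in `[0,1]`) it reduces (OM) and TP-VT on the physical window to the bilinear
conjecture TPos-VT (`VertexTransitiveFidelitySupermodular` of `…SpinMonotoneTPosDefs`).

* `supermodular_of_adjacent` — local (adjacent-cell) supermodularity on `ℕ × ℕ` propagates to all
  rectangles; `tp2_of_adjacent` — multiplicative version for positive kernels (the order-2 case of
  Fekete's criterion, cf. `Literature.Analysis.TotalPositivity.FeketeCriterion`).
* `overlap_succ_le_one`, `incr_dot_nonneg_above`, `incr_dot_nonpos_below` — bookkeeping.
* `overlapMonotone_of_tangentPositive` — rows of the Gram matrix are unimodal with maximum on the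
  diagonal; `gramAdjacentTP2_of_tangentPositive`, `gramTP2_of_tangentPositive` — TP₂.

Port of `Sketch6.lean` §SupermodularGrid + §TangentCriterion (kernel-checked there), with the
predicate `TangentPositive` written out as a hypothesis.  No definition is introduced.
-/

set_option linter.dupNamespace false

namespace Summit.HubbardSuperconductivity.HubbardSuperconductivity.Theorems.AnisotropyChord

open Matrix

/-! ### Local-to-global supermodularity on `ℕ × ℕ` -/

/-- Local (adjacent-cell) supermodularity on `ℕ × ℕ` propagates to all rectangles.  D. Topkis,
*Supermodularity and Complementarity* (1998) §2.6. [folklore] -/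
theorem supermodular_of_adjacent (L : ℕ → ℕ → ℝ)
    (hadj : ∀ i j, L i (j+1) + L (i+1) j ≤ L i j + L (i+1) (j+1)) :
    ∀ a b i j, L i (j+b) + L (i+a) j ≤ L i j + L (i+a) (j+b) := by
  have step1 : ∀ b i j, L i (j+b) + L (i+1) j ≤ L i j + L (i+1) (j+b) := by
    intro b
    induction b with
    | zero => intro i j; simp only [add_zero]; linarith
    | succ b ih =>
      intro i j
      have h1 := ih i j
      have h2 := hadj i (j+b)
      have e1 : j + (b + 1) = j + b + 1 := by omega
      rw [e1]
      linarith
  intro a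
  induction a with
  | zero => intro b i j; simp only [add_zero]; linarith
  | succ a ih =>
    intro b i j
    have h1 := ih b i j
    have h2 := step1 b (i+a) j
    have e1 : i + (a + 1) = i + a + 1 := by omega
    rw [e1]
    linarith

/-- Multiplicative version: a positive kernel on `ℕ × ℕ` whose adjacent `2 × 2` minors are non-negative
has all (row-ordered, column-ordered) `2 × 2` minors non-negative (TP₂; the order-2 case of Fekete's
criterion). [folklore] -/
theorem tp2_of_adjacent (K : ℕ → ℕ → ℝ) (hpos : ∀ i j, 0 < K i j)
    (hadj : ∀ i j, K i (j+1) * K (i+1) j ≤ K i j * K (i+1) (j+1)) :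
    ∀ a b i j, K i (j+b) * K (i+a) j ≤ K i j * K (i+a) (j+b) := by
  have hlog : ∀ a b i j, Real.log (K i (j+b)) + Real.log (K (i+a) j)
      ≤ Real.log (K i j) + Real.log (K (i+a) (j+b)) := by
    apply supermodular_of_adjacent (fun i j => Real.log (K i j))
    intro i j
    have h := hadj i j
    rw [← Real.log_mul (hpos i (j+1)).ne' (hpos (i+1) j).ne',
        ← Real.log_mul (hpos i j).ne' (hpos (i+1) (j+1)).ne']
    exact Real.log_le_log (mul_pos (hpos _ _) (hpos _ _)) h
  intro a b i j
  have h := hlog a b i j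
  rw [← Real.log_mul (hpos i (j+b)).ne' (hpos (i+a) j).ne',
      ← Real.log_mul (hpos i j).ne' (hpos (i+a) (j+b)).ne'] at h
  exact (Real.log_le_log_iff (mul_pos (hpos _ _) (hpos _ _)) (mul_pos (hpos _ _) (hpos _ _))).1 h

/-! ### The tangent criterion -/

section TangentCriterion

variable {d : ℕ} (ψ : ℕ → (Fin d → ℝ))

/-- Overlaps of consecutive unit vectors are at most one (from `0 ≤ ‖ψ_{i+1} − ψ_i‖²`). [folklore] -/
theorem overlap_succ_le_one (hunit : ∀ i, ψ i ⬝ᵥ ψ i = 1) (i : ℕ) : ψ i ⬝ᵥ ψ (i+1) ≤ 1 := by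
  have h : 0 ≤ (ψ (i+1) - ψ i) ⬝ᵥ (ψ (i+1) - ψ i) :=
    Finset.sum_nonneg (fun k _ => mul_self_nonneg _)
  rw [sub_dotProduct, dotProduct_sub, dotProduct_sub, hunit, hunit, dotProduct_comm (ψ (i+1)) (ψ i)] at h
  linarith

/-- Upper side: `⟨ψ_{i+1} − ψ_i, ψ_{i+1+n}⟩ ≥ 0` under tangent positivity. [folklore] -/
theorem incr_dot_nonneg_above (hunit : ∀ i, ψ i ⬝ᵥ ψ i = 1)
    (htan : ∀ i j, 0 ≤ (ψ (i+1) - ψ i) ⬝ᵥ (ψ (j+1) - ψ j)) :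
    ∀ n i, 0 ≤ (ψ (i+1) - ψ i) ⬝ᵥ ψ (i+1+n) := by
  intro n
  induction n with
  | zero =>
    intro i
    have h := overlap_succ_le_one ψ hunit i
    rw [add_zero, sub_dotProduct, hunit]; linarith
  | succ n ih =>
    intro i
    have e : ψ (i+1+(n+1)) = ψ (i+1+n) + (ψ (i+1+n+1) - ψ (i+1+n)) := by
      rw [show i+1+(n+1) = i+1+n+1 by omega]; abel
    rw [e, dotProduct_add]
    exact add_nonneg (ih i) (htan i (i+1+n))

/-- Lower side: `⟨ψ_{j+n+1} − ψ_{j+n}, ψ_j⟩ ≤ 0` under tangent positivity. [folklore] -/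
theorem incr_dot_nonpos_below (hunit : ∀ i, ψ i ⬝ᵥ ψ i = 1)
    (htan : ∀ i j, 0 ≤ (ψ (i+1) - ψ i) ⬝ᵥ (ψ (j+1) - ψ j)) :
    ∀ n j, (ψ (j+n+1) - ψ (j+n)) ⬝ᵥ ψ j ≤ 0 := by
  intro n
  induction n with
  | zero =>
    intro j
    have h := overlap_succ_le_one ψ hunit j
    rw [add_zero, sub_dotProduct, hunit, dotProduct_comm]; linarith
  | succ n ih =>
    intro j
    have e : ψ j = ψ (j+1) - (ψ (j+1) - ψ j) := by abel
    have h1 := ih (j+1)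
    have h2 := htan (j+(n+1)) j
    rw [show j+1+n+1 = j+(n+1)+1 by omega, show j+1+n = j+(n+1) by omega] at h1
    rw [e, dotProduct_sub]
    linarith

/-- **Tangent criterion, (OM) part**: for unit vectors with tangent positivity the Gram matrix
`G i j = ⟨ψ_i, ψ_j⟩` is unimodal along rows with its maximum on the diagonal.  Theory seat memo
ROTOR-THEORY-6 §58. [folklore] -/
theorem overlapMonotone_of_tangentPositive (hunit : ∀ i, ψ i ⬝ᵥ ψ i = 1)
    (htan : ∀ i j, 0 ≤ (ψ (i+1) - ψ i) ⬝ᵥ (ψ (j+1) - ψ j)) :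
    (∀ i j, i + 1 ≤ j → ψ i ⬝ᵥ ψ j ≤ ψ (i+1) ⬝ᵥ ψ j) ∧
    (∀ i j, j ≤ i → ψ (i+1) ⬝ᵥ ψ j ≤ ψ i ⬝ᵥ ψ j) := by
  constructor
  · intro i j hij
    obtain ⟨n, rfl⟩ : ∃ n, j = i + 1 + n := ⟨j - (i+1), by omega⟩
    have h := incr_dot_nonneg_above ψ hunit htan n i
    rw [sub_dotProduct] at h; linarith
  · intro i j hji
    obtain ⟨n, rfl⟩ : ∃ n, i = j + n := ⟨i - j, by omega⟩
    have h := incr_dot_nonpos_below ψ hunit htan n j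
    rw [sub_dotProduct] at h; linarith

/-- **Tangent criterion, TP₂ part (adjacent minors)** — from the four-point identity
`G(i+1,j+1) = G(i+1,j) + G(i,j+1) − G(i,j) + ⟨δ_i, δ_j⟩`. Theory seat memo ROTOR-THEORY-6 §58.
[folklore] -/
theorem gramAdjacentTP2_of_tangentPositive (hunit : ∀ i, ψ i ⬝ᵥ ψ i = 1)
    (hpos : ∀ i j, 0 < ψ i ⬝ᵥ ψ j) (htan : ∀ i j, 0 ≤ (ψ (i+1) - ψ i) ⬝ᵥ (ψ (j+1) - ψ j)) :
    ∀ i j, (ψ i ⬝ᵥ ψ (j+1)) * (ψ (i+1) ⬝ᵥ ψ j) ≤ (ψ i ⬝ᵥ ψ j) * (ψ (i+1) ⬝ᵥ ψ (j+1)) := by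
  have hOM := overlapMonotone_of_tangentPositive ψ hunit htan
  have four : ∀ i j, ψ (i+1) ⬝ᵥ ψ (j+1)
      = ψ (i+1) ⬝ᵥ ψ j + ψ i ⬝ᵥ ψ (j+1) - ψ i ⬝ᵥ ψ j + (ψ (i+1) - ψ i) ⬝ᵥ (ψ (j+1) - ψ j) := by
    intro i j
    rw [sub_dotProduct, dotProduct_sub, dotProduct_sub]; ring
  have main : ∀ i j, i + 1 ≤ j →
      (ψ i ⬝ᵥ ψ (j+1)) * (ψ (i+1) ⬝ᵥ ψ j) ≤ (ψ i ⬝ᵥ ψ j) * (ψ (i+1) ⬝ᵥ ψ (j+1)) := by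
    intro i j hij
    have hA : ψ i ⬝ᵥ ψ j ≤ ψ (i+1) ⬝ᵥ ψ j := hOM.1 i j hij
    have hB : ψ (j+1) ⬝ᵥ ψ i ≤ ψ j ⬝ᵥ ψ i := hOM.2 j i (by omega)
    rw [dotProduct_comm (ψ (j+1)), dotProduct_comm (ψ j) (ψ i)] at hB
    have hT := htan i j
    have hG := hpos i j
    rw [four i j]
    nlinarith [mul_nonneg (sub_nonneg.2 hA) (sub_nonneg.2 hB), mul_nonneg hG.le hT]
  intro i j
  rcases lt_trichotomy i j with h | h | h
  · exact main i j (by omega)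
  · subst h
    have h1 := overlap_succ_le_one ψ hunit i
    have h0 := hpos i (i+1)
    rw [hunit, hunit, dotProduct_comm (ψ (i+1)) (ψ i)]
    nlinarith
  · have hm := main j i (by omega)
    rw [dotProduct_comm (ψ i) (ψ (j+1)), dotProduct_comm (ψ (i+1)) (ψ j),
        dotProduct_comm (ψ i) (ψ j), dotProduct_comm (ψ (i+1)) (ψ (j+1))]
    linarith [hm]

/-- **Tangent criterion, full TP₂**: all ordered `2 × 2` minors of the Gram matrix of a tangent-positive
curve of unit vectors with positive overlaps are non-negative.  Theory seat memo ROTOR-THEORY-6 §58.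
[folklore] -/
theorem gramTP2_of_tangentPositive (hunit : ∀ i, ψ i ⬝ᵥ ψ i = 1)
    (hpos : ∀ i j, 0 < ψ i ⬝ᵥ ψ j) (htan : ∀ i j, 0 ≤ (ψ (i+1) - ψ i) ⬝ᵥ (ψ (j+1) - ψ j)) :
    ∀ a b i j, (ψ i ⬝ᵥ ψ (j+b)) * (ψ (i+a) ⬝ᵥ ψ j) ≤ (ψ i ⬝ᵥ ψ j) * (ψ (i+a) ⬝ᵥ ψ (j+b)) :=
  tp2_of_adjacent (fun i j => ψ i ⬝ᵥ ψ j) hpos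
    (gramAdjacentTP2_of_tangentPositive ψ hunit hpos htan)

end TangentCriterion

end Summit.HubbardSuperconductivity.HubbardSuperconductivity.Theorems.AnisotropyChord
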